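import Literature.Probability.LatticeModels.TorusFourierWeightedL1Prod
import HarnessLib

/-!
# Mixed weights for product-torus character sums: differences in several directions at once

Topic `Literature/Probability/LatticeModels`; companion of `TorusFourierWeightedL1Prod.lean`.  The weighted Plancherel
inequalities there carry ONE weight factor (one direction of one torus factor).  To bound the `ℓ¹` norm of a space-time
lattice propagator with a PRODUCT weight `W(a,b) = (1 + c₀ A(a))(1 + c₁ B₁(b))(1 + c₂ B₂(b))` — whose inverse sums factorise
into one-dimensional lattice sums, with no fractional powers — one needs the MIXED terms `A·B₁`, `A·B₂`, `B₁·B₂`, `A·B₁·B₂`.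
They all come from the POINTWISE identities behind the one-direction inequalities: a difference of the symbol in the
direction `v` of the second factor multiplies the character sum by `conj χ_v(b) - 1`, in the direction `u` of the first
factor by `conj χ_u(a) - 1` (`TorusFourierDecayFromDifferences.sum_torusChar_smul_fwdDiff_iter` + Fubini), and the chord
bound `‖χ_v(b) - 1‖ ≥ 4|b̃_v|/L₂` turns each factor into a weight; the product Plancherel then prices the product of weights by
the `ℓ²` norm of the MIXED difference of the symbol (Benfatto–Giuliani–Mastropietro 2006, Lemma 2.2 / (2.36aa) at finite
`(β, L)`: decay in every space-time direction from differences in every dual direction).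

* `prodChar_fwdDiff_snd`, `prodChar_fwdDiff_fst` — `S[Δ_v^N G](a,b) = (conj χ_v(b) - 1)^N S[G](a,b)` and the same in `a`;
* **`sum_sum_mixedWeight_mul_norm_sq_le`** — for a direction `u` of the first factor (power `N₀`) and two directions
  `v₁, v₂` of the second (powers `N₁, N₂`):
  `Σ_{a,b} (4|ã_u|/L₁)^{2N₀}(4|b̃_{v₁}|/L₂)^{2N₁}(4|b̃_{v₂}|/L₂)^{2N₂} ‖S[G](a,b)‖² ≤ L₁^{d₁}L₂^{d₂} Σ ‖Δ_u^{N₀}Δ_{v₁}^{N₁}Δ_{v₂}^{N₂} G‖²`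
  (any exponent may be `0`; the three-factor product weight of a space-time propagator in `d = 2` is covered).

Everything is proved; no definitions, no named facts.

## Sources

G. Benfatto, A. Giuliani, V. Mastropietro, Ann. Henri Poincaré 7 (2006) 809–898, Lemma 2.2, (2.36aa) and footnote ¹
(`BenfattoGiulianiMastropietro2006`); S. Friedli, Y. Velenik, *Statistical Mechanics of Lattice Systems* (2017), §10.4
(`FriedliVelenik2017`).
-/

noncomputable section

open Finset Complex
open scoped Real ComplexConjugate

namespace Literature.Probability.LatticeModels

variable {d₁ L₁ d₂ L₂ : ℕ} [NeZero L₁] [NeZero L₂]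

/-- **A difference in the second factor multiplies the product character sum by `conj χ_v(b) - 1`**:
`Σ_{p,p'} χ_p(a)χ_{p'}(b) (Δ_v^N G(p,·))(p') = (conj χ_v(b) - 1)^N Σ_{p,p'} χ_p(a)χ_{p'}(b) G(p,p')`.
[cite: BenfattoGiulianiMastropietro2006, (2.36aa)] -/
theorem prodChar_fwdDiff_snd (G : TorusSite d₁ L₁ → TorusSite d₂ L₂ → ℂ) (v : TorusSite d₂ L₂) (N : ℕ)
    (a : TorusSite d₁ L₁) (b : TorusSite d₂ L₂) :
    ∑ p, ∑ p', torusChar p a * torusChar p' b * ((fwdDiff v)^[N] (G p)) p' =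
      (conj (torusChar v b) - 1) ^ N * ∑ p, ∑ p', torusChar p a * torusChar p' b * G p p' := by
  rw [mul_sum]
  refine sum_congr rfl fun p _ => ?_
  have h := sum_torusChar_smul_fwdDiff_iter (E := ℂ) v b N (G p)
  simp only [smul_eq_mul] at h
  have e1 : ∑ p', torusChar p a * torusChar p' b * ((fwdDiff v)^[N] (G p)) p' =
      torusChar p a * ∑ p', torusChar p' b * ((fwdDiff v)^[N] (G p)) p' := by
    rw [mul_sum]; refine sum_congr rfl fun p' _ => ?_; ring
  have e2 : ∑ p', torusChar p a * torusChar p' b * G p p' = torusChar p a * ∑ p', torusChar p' b * G p p' := by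
    rw [mul_sum]; refine sum_congr rfl fun p' _ => ?_; ring
  rw [e1, e2, h]
  ring

/-- **A difference in the first factor multiplies the product character sum by `conj χ_u(a) - 1`**:
`Σ_{p,p'} χ_p(a)χ_{p'}(b) (Δ_u^N G(·,p'))(p) = (conj χ_u(a) - 1)^N Σ_{p,p'} χ_p(a)χ_{p'}(b) G(p,p')`.
[cite: BenfattoGiulianiMastropietro2006, (2.36aa)] -/
theorem prodChar_fwdDiff_fst (G : TorusSite d₁ L₁ → TorusSite d₂ L₂ → ℂ) (u : TorusSite d₁ L₁) (N : ℕ)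
    (a : TorusSite d₁ L₁) (b : TorusSite d₂ L₂) :
    ∑ p, ∑ p', torusChar p a * torusChar p' b * ((fwdDiff u)^[N] (fun q => G q p')) p =
      (conj (torusChar u a) - 1) ^ N * ∑ p, ∑ p', torusChar p a * torusChar p' b * G p p' := by
  rw [sum_comm]
  conv_rhs => rw [sum_comm, mul_sum]
  refine sum_congr rfl fun p' _ => ?_
  have h := sum_torusChar_smul_fwdDiff_iter (E := ℂ) u a N (fun q => G q p')
  simp only [smul_eq_mul] at h
  have e1 : ∑ p, torusChar p a * torusChar p' b * ((fwdDiff u)^[N] (fun q => G q p')) p =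
      torusChar p' b * ∑ p, torusChar p a * ((fwdDiff u)^[N] (fun q => G q p')) p := by
    rw [mul_sum]; refine sum_congr rfl fun p _ => ?_; ring
  have e2 : ∑ p, torusChar p a * torusChar p' b * G p p' = torusChar p' b * ∑ p, torusChar p a * G p p' := by
    rw [mul_sum]; refine sum_congr rfl fun p _ => ?_; ring
  rw [e1, e2, h]
  ring

omit [NeZero L₁] [NeZero L₂] in
/-- The norm of `conj χ - 1` is that of `χ - 1`. [folklore] -/
private theorem norm_conj_sub_one (z : ℂ) : ‖conj z - 1‖ = ‖z - 1‖ := by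
  rw [show conj z - 1 = conj (z - 1) by rw [map_sub, map_one], Complex.norm_conj]

/-- **Mixed weighted Plancherel on the product torus**: for a direction `u` of the first factor with `N₀` differences and
two directions `v₁, v₂` of the second factor with `N₁, N₂` differences,
`Σ_{a,b} (4|ã_u(a)|/L₁)^{2N₀} (4|b̃_{v₁}(b)|/L₂)^{2N₁} (4|b̃_{v₂}(b)|/L₂)^{2N₂} ‖S[G](a,b)‖²
   ≤ L₁^{d₁} L₂^{d₂} Σ_{p,p'} ‖(Δ_u^{N₀} (q ↦ (Δ_{v₁}^{N₁} (Δ_{v₂}^{N₂} G(q,·)))(p')))(p)‖²`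
— every term of the product weight `(1 + c₀A)(1 + c₁B₁)(1 + c₂B₂)` of a space-time lattice propagator is paid by the `ℓ²` norm
of the corresponding mixed difference of its symbol. [cite: BenfattoGiulianiMastropietro2006, Lemma 2.2 and (2.36aa)] -/
theorem sum_sum_mixedWeight_mul_norm_sq_le (G : TorusSite d₁ L₁ → TorusSite d₂ L₂ → ℂ) (u : TorusSite d₁ L₁)
    (v₁ v₂ : TorusSite d₂ L₂) (N₀ N₁ N₂ : ℕ) :
    ∑ a : TorusSite d₁ L₁, ∑ b : TorusSite d₂ L₂,
        (4 * |((∑ j, u j * a j).valMinAbs : ℝ)| / L₁) ^ (2 * N₀) *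
          ((4 * |((∑ j, v₁ j * b j).valMinAbs : ℝ)| / L₂) ^ (2 * N₁) *
            ((4 * |((∑ j, v₂ j * b j).valMinAbs : ℝ)| / L₂) ^ (2 * N₂) *
              ‖∑ p, ∑ p', torusChar p a * torusChar p' b * G p p'‖ ^ 2)) ≤
      (L₁ : ℝ) ^ d₁ * (L₂ : ℝ) ^ d₂ *
        ∑ p, ∑ p', ‖((fwdDiff u)^[N₀] (fun q => ((fwdDiff v₁)^[N₁] ((fwdDiff v₂)^[N₂] (G q))) p')) p‖ ^ 2 := by
  -- the mixed-differenced symbol and its character sum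
  set G₂ : TorusSite d₁ L₁ → TorusSite d₂ L₂ → ℂ := fun q => (fwdDiff v₂)^[N₂] (G q) with hG₂
  set G₁ : TorusSite d₁ L₁ → TorusSite d₂ L₂ → ℂ := fun q => (fwdDiff v₁)^[N₁] (G₂ q) with hG₁
  set G₀ : TorusSite d₁ L₁ → TorusSite d₂ L₂ → ℂ := fun p p' => ((fwdDiff u)^[N₀] (fun q => G₁ q p')) p with hG₀
  have hP := sum_sum_norm_sq_prodChar G₀
  have hrhs : ∑ p, ∑ p', ‖G₀ p p'‖ ^ 2 =
      ∑ p, ∑ p', ‖((fwdDiff u)^[N₀] (fun q => ((fwdDiff v₁)^[N₁] ((fwdDiff v₂)^[N₂] (G q))) p')) p‖ ^ 2 := by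
    simp only [hG₀, hG₁, hG₂]
  rw [← hrhs, ← hP]
  refine sum_le_sum fun a _ => sum_le_sum fun b _ => ?_
  -- the pointwise identity `S[G₀](a,b) = (conj χ_u(a)-1)^{N₀} (conj χ_{v₁}(b)-1)^{N₁} (conj χ_{v₂}(b)-1)^{N₂} S[G](a,b)`
  have hid : ∑ p, ∑ p', torusChar p a * torusChar p' b * G₀ p p' =
      (conj (torusChar u a) - 1) ^ N₀ * ((conj (torusChar v₁ b) - 1) ^ N₁ * ((conj (torusChar v₂ b) - 1) ^ N₂ *
        ∑ p, ∑ p', torusChar p a * torusChar p' b * G p p')) := by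
    rw [hG₀, prodChar_fwdDiff_fst G₁ u N₀ a b, hG₁]
    rw [show (∑ p, ∑ p', torusChar p a * torusChar p' b * (fun q => (fwdDiff v₁)^[N₁] (G₂ q)) p p') =
      ∑ p, ∑ p', torusChar p a * torusChar p' b * ((fwdDiff v₁)^[N₁] (G₂ p)) p' from rfl,
      prodChar_fwdDiff_snd G₂ v₁ N₁ a b, hG₂]
    rw [show (∑ p, ∑ p', torusChar p a * torusChar p' b * (fun q => (fwdDiff v₂)^[N₂] (G q)) p p') =
      ∑ p, ∑ p', torusChar p a * torusChar p' b * ((fwdDiff v₂)^[N₂] (G p)) p' from rfl,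
      prodChar_fwdDiff_snd G v₂ N₂ a b]
  set wa : ℝ := 4 * |((∑ j, u j * a j).valMinAbs : ℝ)| / L₁ with hwa
  set w1 : ℝ := 4 * |((∑ j, v₁ j * b j).valMinAbs : ℝ)| / L₂ with hw1
  set w2 : ℝ := 4 * |((∑ j, v₂ j * b j).valMinAbs : ℝ)| / L₂ with hw2
  set S : ℂ := ∑ p, ∑ p', torusChar p a * torusChar p' b * G p p' with hS
  have hwa0 : 0 ≤ wa := by rw [hwa]; positivity
  have hw10 : 0 ≤ w1 := by rw [hw1]; positivity
  have hw20 : 0 ≤ w2 := by rw [hw2]; positivity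
  have ha : wa ^ N₀ ≤ ‖conj (torusChar u a) - 1‖ ^ N₀ := by
    rw [norm_conj_sub_one]; exact pow_le_pow_left₀ hwa0 (le_norm_torusChar_sub_one u a) N₀
  have h1 : w1 ^ N₁ ≤ ‖conj (torusChar v₁ b) - 1‖ ^ N₁ := by
    rw [norm_conj_sub_one]; exact pow_le_pow_left₀ hw10 (le_norm_torusChar_sub_one v₁ b) N₁
  have h2 : w2 ^ N₂ ≤ ‖conj (torusChar v₂ b) - 1‖ ^ N₂ := by
    rw [norm_conj_sub_one]; exact pow_le_pow_left₀ hw20 (le_norm_torusChar_sub_one v₂ b) N₂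
  have hpt : wa ^ N₀ * (w1 ^ N₁ * (w2 ^ N₂ * ‖S‖)) ≤ ‖∑ p, ∑ p', torusChar p a * torusChar p' b * G₀ p p'‖ := by
    rw [hid, norm_mul, norm_mul, norm_mul, norm_pow, norm_pow, norm_pow]
    exact mul_le_mul ha (mul_le_mul h1 (mul_le_mul_of_nonneg_right h2 (norm_nonneg _)) (by positivity) (by positivity))
      (by positivity) (by positivity)
  have h0 : 0 ≤ wa ^ N₀ * (w1 ^ N₁ * (w2 ^ N₂ * ‖S‖)) := by positivity
  calc wa ^ (2 * N₀) * (w1 ^ (2 * N₁) * (w2 ^ (2 * N₂) * ‖S‖ ^ 2))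
      = (wa ^ N₀ * (w1 ^ N₁ * (w2 ^ N₂ * ‖S‖))) ^ 2 := by
        rw [mul_comm 2 N₀, mul_comm 2 N₁, mul_comm 2 N₂, pow_mul, pow_mul, pow_mul]; ring
    _ ≤ ‖∑ p, ∑ p', torusChar p a * torusChar p' b * G₀ p p'‖ ^ 2 := pow_le_pow_left₀ h0 hpt 2

end Literature.Probability.LatticeModels

end
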